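import Summits.QuantumFields.YangMills.Theorems.FluctuationComparisonRegPrIntLS1aAlphaMemOfRunTower
import Literature.MathematicalPhysics.QuantumFieldTheory.Balaban1983to89.T3UnitLawGaugeInvariance
import Literature.MathematicalPhysics.QuantumFieldTheory.Balaban1983to89.B10Eq26MeasureInv
import HarnessLib

/-!
# S1a · UV3-NODE §69.16′ — THE CUT TOWER OF S1aᴴ IS GAUGE INVARIANT, HENCE ITS CONTINUOUS DENSITY IS A.E. GAUGE INVARIANT:
# the `hcinv` binder of ✓p828515 `exists_admissible_schedule_memOfRun_tower` DISCHARGED for the line's own tower objects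

Cell `ym3-torus` (YM ladder rung R3 = continuum `SU(2)` Yang–Mills on the three-torus — a RUNG: NOT d = 4, NOT infinite volume, NOT a mass gap, NOT Clay).
Width seat «width 20» `ym3-torus-px20` (gen 23), FREE px helper on crux `stmt-QuantumFields-20520`, count-neutral, DEFINITION-FREE, default heartbeats.

WHAT.  px8 g24's (m)-door of record for the tower (✓p828515) takes, at every height `j ≤ K` of every cut-and-anchored tower `μ` of S1aᴴ, the letter
`hcinv : ∀ g, (fun V => ρᶜ (g • V)) =ᵐ[dU] ρᶜ` — a.e. gauge invariance of the cut tower's continuous density.  This file proves it from the tower's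
DEFINITION (the run system `ν` of S1aᴴ :366–:368 and the cut recursion :370–:372, binders VERBATIM in px8's shape) plus ONE structural hypothesis on the
cut weights, `hχinv : ∀ j u U, χ j (u • U) = χ j U` — which the line's own cut `∏_p max 0 (min 1 ((24∕25·θ − dist1 U(∂p))∕((24∕25 − ½)·θ)))` satisfies
(`sfCut2425_gaugeAct`, §4), so that at the Lines junction `hcinv` is supplied by `exact`.
* §1 `descend_gaugeAct_liftTransf` — covariance of the one-step descent between towers: `descend F ℰ K (u • U) = v • descend F ℰ K U` with the
  block-constant lift `u := liftTransf (v ∘ (siteShift _)⁻¹)` ([Balaban1985Averaging] (11) «Ū^u = (Ū)^u» + the level identification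
  `T3LevelShift.gaugeAct_fieldShift`).
* §2 measure algebra: `map_gaugeAct_map_descend` (a law invariant under the fine gauge group descends to a law invariant under the coarse one),
  `exists_measurableEquiv_gaugeAct` (the action of `u` as a measurable equivalence, inverse `invTransf u`), `map_gaugeAct_withDensity` (an invariant
  law times an invariant weight is invariant — `B10Eq26MeasureInv.map_withDensity_equiv`), `ae_eq_comp_gaugeAct_of_withDensity` (an invariant law
  `dU·(ofReal ∘ ρ)` with `ρ ≥ 0` measurable has `ρ ∘ (g •) =ᵐ[dU] ρ` — `dU` is gauge invariant, ✓`measurePreserving_gaugeAct`, and `withDensity`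
  determines the density a.e.).
* §3 ★★ `map_gaugeAct_run` — every law `ν K j` (`j ≤ K`) of the run system is gauge invariant (downward induction from ✓`map_gaugeAct_gibbsMeasure`);
  ★★ `map_gaugeAct_cutTower` — so is every law `μ j` of any tower agreeing with `ν K` from `Ts` up and cut below by invariant weights.
* §4 ★★★ `cutTower_density_ae_gaugeInvariant` — the `hcinv` letter: for `μ j = dU·(ofReal ∘ ρᶜ)` with `ρᶜ ≥ 0` continuous,
  `∀ g, (fun V => ρᶜ (g • V)) =ᵐ[dU] ρᶜ`; `run_density_ae_gaugeInvariant` — the same for the run's density `ρᵗ`; `sfCut2425_gaugeAct` — the line's cut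
  weight is gauge invariant, and ★★★ `cutTower_density_ae_gaugeInvariant_sfCut` — `hcinv` for the `sfCut`-cut tower with NO hypothesis on the cut left.
HONEST FRAMING: structural (gauge covariance of averaging + invariance of Haar and of the Wilson weight); nothing of Bałaban's analysis is asserted or
proved; S1aᴴ's (m)∕(a) remain OPEN; 20520 ∕ `YM3TorusSU2` NOT proved.  Sorry-free, axioms standard.
-/

set_option autoImplicit false

noncomputable section

namespace Summit.QuantumFields.YangMills.Theorems.FluctuationComparisonRegPrIntLS1aCutTowerGaugeInvariant

open MeasureTheory Set
open scoped ENNReal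
open Literature.MathematicalPhysics.QuantumFieldTheory.Balaban1983to89
open T3ContinuumYM3Torus T3UnitScaleTilt T3UnitLawDensityEML BalabanUVClass T3LevelShift
open T3NestedUnitLaws (descend sitesPerDir_descend)
open B12RTGaugeInvariance254 (liftTransf invTransf measurable_gaugeAct measurePreserving_gaugeAct avg_gaugeAct_liftTransf
  gaugeAct_inv_gaugeAct gaugeAct_gaugeAct_inv)
open T3UnitLawGaugeInvariance (map_gaugeAct_gibbsMeasure)
open B10Eq26MeasureInv (map_withDensity_equiv)

/-! ## §1 Covariance of the one-step descent between towers -/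

section Descend

variable (F : T3Family) {G : Type*} [GaugeGroup G] (ℰ : LoopAverage G)

/-- **`D(U^u) = (DU)^v` for the block-constant lift `u` of `v`** — the one-step descent `descend F ℰ K` (unit averaging of tower `K+1`, read on tower `K`)
intertwines the coarse gauge transformation `v` with its lift `liftTransf (v ∘ (siteShift _)⁻¹)` ([Balaban1985Averaging] (11) «Ū^u = (Ū)^u» for
`u` block-constant, then the level identification). [cite: Balaban1985Averaging, (11) p.19] -/
theorem descend_gaugeAct_liftTransf (K : ℕ) (v : GaugeTransf (F.P K) 0 G) (U : GaugeField (F.P (K + 1)) 0 G) :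
    descend F ℰ K (GaugeField.gaugeAct (liftTransf (fun y => v ((siteShift (sitesPerDir_descend F K 0)).symm y))) U) =
      GaugeField.gaugeAct v (descend F ℰ K U) := by
  show fieldShift (sitesPerDir_descend F K 0) ((BlockAveraging.blockAvg (P := F.P (K + 1)) (j := 0) ℰ).avg
      (GaugeField.gaugeAct (liftTransf _) U)) = GaugeField.gaugeAct v (fieldShift (sitesPerDir_descend F K 0) _)
  rw [avg_gaugeAct_liftTransf (by show 0 + 1 ≤ F.m + (K + 1); omega)]
  exact (gaugeAct_fieldShift _ v _).symm

/-- … hence every coarse gauge transformation `v` HAS a fine one `u` with `descend (u • U) = v • descend U` for all `U`. [cite: Balaban1985Averaging, (12) p.19] -/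
theorem exists_descend_gaugeAct (K : ℕ) (v : GaugeTransf (F.P K) 0 G) :
    ∃ u : GaugeTransf (F.P (K + 1)) 0 G, ∀ U, descend F ℰ K (GaugeField.gaugeAct u U) = GaugeField.gaugeAct v (descend F ℰ K U) :=
  ⟨_, descend_gaugeAct_liftTransf F ℰ K v⟩

end Descend

/-! ## §2 Measure algebra: invariant laws descend, carry invariant weights, and determine invariant densities -/

section MeasureAlgebra

variable {P : Params} {j : ℕ} {G : Type*} [GaugeGroup G] [MeasurableSpace G] [HaarData G] [RegularGaugeGroup G]

omit [HaarData G] in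
/-- The gauge action of `u` on fields IS a measurable equivalence (inverse: the action of `invTransf u`). [cite: Balaban1987RG1, (1.10) p.262] -/
theorem exists_measurableEquiv_gaugeAct (u : GaugeTransf P j G) :
    ∃ e : GaugeField P j G ≃ᵐ GaugeField P j G,
      (⇑e = GaugeField.gaugeAct u) ∧ (⇑e.symm = GaugeField.gaugeAct (invTransf u)) :=
  ⟨{ toFun := GaugeField.gaugeAct u, invFun := GaugeField.gaugeAct (invTransf u),
      left_inv := fun U => gaugeAct_inv_gaugeAct u U, right_inv := fun U => gaugeAct_gaugeAct_inv u U,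
      measurable_toFun := measurable_gaugeAct u, measurable_invFun := measurable_gaugeAct _ }, rfl, rfl⟩

omit [HaarData G] in
/-- **AN INVARIANT LAW TIMES AN INVARIANT WEIGHT IS INVARIANT**: if `lam.map (u •) = lam` for every gauge transformation `u` and `f (u • U) = f U`, then
`(lam·f).map (v •) = lam·f`. [cite: Balaban1985UV3, (26) p.263] -/
theorem map_gaugeAct_withDensity {lam : Measure (GaugeField P j G)} (hlam : ∀ u : GaugeTransf P j G, lam.map (GaugeField.gaugeAct u) = lam)
    {f : GaugeField P j G → ℝ≥0∞} (hf : ∀ (u : GaugeTransf P j G) (U : GaugeField P j G), f (GaugeField.gaugeAct u U) = f U)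
    (v : GaugeTransf P j G) :
    (lam.withDensity f).map (GaugeField.gaugeAct v) = lam.withDensity f := by
  obtain ⟨e, he, hes⟩ := exists_measurableEquiv_gaugeAct v
  rw [← he, map_withDensity_equiv, he, hlam v]
  congr 1
  funext U
  rw [Function.comp_apply, hes, hf]

/-- **AN INVARIANT LAW WITH A DENSITY HAS AN A.E. INVARIANT DENSITY**: if `lam.map (u •) = lam` for all `u` and `lam = dU·(ofReal ∘ ρ)` with `ρ ≥ 0` measurable, then
`ρ ∘ (g •) =ᵐ[dU] ρ` for every `g` (`dU` is gauge invariant and `withDensity` determines its density a.e.). [cite: Balaban1987RG1, (2.1) p.265] -/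
theorem ae_eq_comp_gaugeAct_of_withDensity {lam : Measure (GaugeField P j G)}
    (hlam : ∀ u : GaugeTransf P j G, lam.map (GaugeField.gaugeAct u) = lam) {ρ : GaugeField P j G → ℝ} (hρm : Measurable ρ) (hρ0 : ∀ V, 0 ≤ ρ V)
    (hlamρ : lam = (fieldMeasure P j G).withDensity (fun V => ENNReal.ofReal (ρ V))) (g : GaugeTransf P j G) :
    (fun V => ρ (GaugeField.gaugeAct g V)) =ᵐ[fieldMeasure P j G] ρ := by
  -- the action of `invTransf g` as an equivalence; its inverse is the action of `g`
  obtain ⟨e, he, hes⟩ := exists_measurableEquiv_gaugeAct (invTransf g)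
  have hg : GaugeField.gaugeAct (invTransf (invTransf g)) = GaugeField.gaugeAct g := by
    congr 1; funext x; simp [invTransf]
  rw [hg] at hes
  -- push `lam = dU·f` forward along `e`: invariance of `lam` and of `dU` give `dU·(f ∘ (g •)) = dU·f`
  have h1 : (lam.map e) = lam := by rw [he]; exact hlam _
  have h2 : ((fieldMeasure P j G).withDensity (fun V => ENNReal.ofReal (ρ V))).map e =
      (fieldMeasure P j G).withDensity ((fun V => ENNReal.ofReal (ρ V)) ∘ e.symm) := by
    rw [map_withDensity_equiv]
    congr 1
    rw [he]
    exact (measurePreserving_gaugeAct _).map_eq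
  rw [← hlamρ, h1, hlamρ, hes] at h2
  -- `withDensity` determines the density a.e.
  have hfm : Measurable fun V => ENNReal.ofReal (ρ V) := ENNReal.measurable_ofReal.comp hρm
  have hae := (withDensity_eq_iff_of_sigmaFinite hfm.aemeasurable (hfm.comp (measurable_gaugeAct g)).aemeasurable).1 h2
  filter_upwards [hae] with V hV
  exact ((ENNReal.ofReal_eq_ofReal_iff (hρ0 _) (hρ0 _)).1 hV).symm

end MeasureAlgebra

section DescendLaw

variable (F : T3Family) {G : Type*} [GaugeGroup G] [MeasurableSpace G] [HaarData G] [RegularGaugeGroup G]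
  (ℰ : LoopAverage G) (hE : ℰ.MeasurableE)

include hE

omit [HaarData G] in
/-- **A LAW INVARIANT UNDER THE FINE GAUGE GROUP DESCENDS TO A LAW INVARIANT UNDER THE COARSE ONE**: `((descend F ℰ K)_* lam).map (v •) = (descend F ℰ K)_* lam`
(realise `v` by its block-constant lift, §1). [cite: Balaban1987RG1, (2.1) p.265] -/
theorem map_gaugeAct_map_descend (K : ℕ) {lam : Measure (GaugeField (F.P (K + 1)) 0 G)}
    (hlam : ∀ u : GaugeTransf (F.P (K + 1)) 0 G, lam.map (GaugeField.gaugeAct u) = lam) (v : GaugeTransf (F.P K) 0 G) :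
    (lam.map (descend F ℰ K)).map (GaugeField.gaugeAct v) = lam.map (descend F ℰ K) := by
  have hD : Measurable (descend F ℰ K : GaugeField (F.P (K + 1)) 0 G → GaugeField (F.P K) 0 G) :=
    T3NestedUnitLaws.measurable_descend F ℰ hE K
  obtain ⟨u, hu⟩ := exists_descend_gaugeAct F ℰ K v
  rw [Measure.map_map (measurable_gaugeAct v) hD]
  have hcomp : (GaugeField.gaugeAct v ∘ descend F ℰ K : GaugeField (F.P (K + 1)) 0 G → GaugeField (F.P K) 0 G) =
      descend F ℰ K ∘ GaugeField.gaugeAct u := funext fun U => (hu U).symm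
  rw [hcomp, ← Measure.map_map hD (measurable_gaugeAct u), hlam u]

end DescendLaw

/-! ## §3 The run system and every cut tower of S1aᴴ are gauge invariant -/

section Tower

variable (F : T3Family) {G : Type*} [GaugeGroup G] [MeasurableSpace G] [HaarData G] [RegularGaugeGroup G]
  (ℰ : LoopAverage G) (hE : ℰ.MeasurableE) {γ : ℝ}

include hE

/-- ★★ **EVERY LAW OF THE RUN SYSTEM IS GAUGE INVARIANT**: for `ν K K = gibbsMeasure (β_K)` and `ν K j = (descend F ℰ j)_* ν K (j+1)` (`j < K`), one has
`(ν K j).map (v •) = ν K j` for all `j ≤ K` and all `v` (`γ ≥ 0`: the Wilson weight is a class function of the plaquette variables, ✓`map_gaugeAct_gibbsMeasure`;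
then §2 down the tower). [cite: Balaban1987RG1, (2.1) p.265] -/
theorem map_gaugeAct_run (hγ : 0 ≤ γ) (ν : ℕ → (j : ℕ) → Measure (GaugeField (F.P j) 0 G))
    (hν1 : ∀ K, ν K K = T4GenFunBounds.gibbsMeasure (F.P K) ((F.scheme ℰ γ).β K))
    (hν2 : ∀ K j, j < K → ν K j = Measure.map (descend F ℰ j) (ν K (j + 1))) (K : ℕ) :
    ∀ j, j ≤ K → ∀ v : GaugeTransf (F.P j) 0 G, (ν K j).map (GaugeField.gaugeAct v) = ν K j := by
  suffices h : ∀ d j, j + d = K → ∀ v : GaugeTransf (F.P j) 0 G, (ν K j).map (GaugeField.gaugeAct v) = ν K j by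
    intro j hj; exact h (K - j) j (by omega)
  intro d
  induction d with
  | zero =>
      intro j hj v
      obtain rfl : j = K := by omega
      rw [hν1]
      exact map_gaugeAct_gibbsMeasure (F.P j) (F.scheme_β_nonneg ℰ hγ j) v
  | succ d ih =>
      intro j hj v
      have hjK : j < K := by omega
      rw [hν2 K j hjK]
      exact map_gaugeAct_map_descend F ℰ hE j (ih (j + 1) (by omega)) v

/-- ★★ **EVERY LAW OF A CUT TOWER IS GAUGE INVARIANT**: for the run system `ν` as above and any tower `μ` with `μ j = ν K j` for `Ts ≤ j` and
`μ j = (descend F ℰ j)_* (μ (j+1)·(ofReal ∘ χ (j+1)))` for `j < Ts`, cut by GAUGE-INVARIANT weights `χ`, one has `(μ j).map (v •) = μ j` for all `j ≤ K`, all `v`.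
[cite: Balaban1985UV3, (41) p.266; Balaban1987RG1, (2.1) p.265] -/
theorem map_gaugeAct_cutTower (hγ : 0 ≤ γ) (ν : ℕ → (j : ℕ) → Measure (GaugeField (F.P j) 0 G))
    (hν1 : ∀ K, ν K K = T4GenFunBounds.gibbsMeasure (F.P K) ((F.scheme ℰ γ).β K))
    (hν2 : ∀ K j, j < K → ν K j = Measure.map (descend F ℰ j) (ν K (j + 1)))
    {K Ts : ℕ} (hTs : Ts ≤ K) (μ : (j : ℕ) → Measure (GaugeField (F.P j) 0 G)) (χ : (j : ℕ) → GaugeField (F.P j) 0 G → ℝ)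
    (hχinv : ∀ (j : ℕ) (u : GaugeTransf (F.P j) 0 G) (U : GaugeField (F.P j) 0 G), χ j (GaugeField.gaugeAct u U) = χ j U)
    (hμ1 : ∀ j, Ts ≤ j → μ j = ν K j)
    (hμ2 : ∀ j, j < Ts → μ j = Measure.map (descend F ℰ j) ((μ (j + 1)).withDensity fun U => ENNReal.ofReal (χ (j + 1) U))) :
    ∀ j, j ≤ K → ∀ v : GaugeTransf (F.P j) 0 G, (μ j).map (GaugeField.gaugeAct v) = μ j := by
  have hrun := map_gaugeAct_run F ℰ hE hγ ν hν1 hν2 K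
  -- downward induction on `j` from `Ts`
  suffices h : ∀ d j, j + d = Ts → ∀ v : GaugeTransf (F.P j) 0 G, (μ j).map (GaugeField.gaugeAct v) = μ j by
    intro j hj v
    by_cases hjT : Ts ≤ j
    · rw [hμ1 j hjT]; exact hrun j hj v
    · exact h (Ts - j) j (by omega) v
  intro d
  induction d with
  | zero => intro j hj v; rw [hμ1 j (by omega)]; exact hrun j (by omega) v
  | succ d ih =>
      intro j hj v
      have hjT : j < Ts := by omega
      rw [hμ2 j hjT]
      exact map_gaugeAct_map_descend F ℰ hE j
        (fun u => map_gaugeAct_withDensity (ih (j + 1) (by omega)) (fun u' U => by rw [hχinv (j + 1) u' U]) u) v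

/-- ★★ **THE `hcinv` LETTER, GENERIC GROUP**: at a height `j ≤ K` where the cut tower's law has a measurable density `ρ ≥ 0` w.r.t. `dU`, that density is a.e. gauge invariant:
`∀ g, (fun V => ρ (g • V)) =ᵐ[dU] ρ`. [cite: Balaban1985UV3, (41) p.266; Balaban1987RG1, (2.1) p.265] -/
theorem cutTower_density_ae_gaugeInvariant' (hγ : 0 ≤ γ) (ν : ℕ → (j : ℕ) → Measure (GaugeField (F.P j) 0 G))
    (hν1 : ∀ K, ν K K = T4GenFunBounds.gibbsMeasure (F.P K) ((F.scheme ℰ γ).β K))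
    (hν2 : ∀ K j, j < K → ν K j = Measure.map (descend F ℰ j) (ν K (j + 1)))
    {K Ts : ℕ} (hTs : Ts ≤ K) (μ : (j : ℕ) → Measure (GaugeField (F.P j) 0 G)) (χ : (j : ℕ) → GaugeField (F.P j) 0 G → ℝ)
    (hχinv : ∀ (j : ℕ) (u : GaugeTransf (F.P j) 0 G) (U : GaugeField (F.P j) 0 G), χ j (GaugeField.gaugeAct u U) = χ j U)
    (hμ1 : ∀ j, Ts ≤ j → μ j = ν K j)
    (hμ2 : ∀ j, j < Ts → μ j = Measure.map (descend F ℰ j) ((μ (j + 1)).withDensity fun U => ENNReal.ofReal (χ (j + 1) U)))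
    {j : ℕ} (hjK : j ≤ K) {ρ : GaugeField (F.P j) 0 G → ℝ} (hρm : Measurable ρ) (hρ0 : ∀ V, 0 ≤ ρ V)
    (hμρ : μ j = (fieldMeasure (F.P j) 0 G).withDensity (fun V => ENNReal.ofReal (ρ V))) :
    ∀ g : GaugeTransf (F.P j) 0 G, (fun V => ρ (GaugeField.gaugeAct g V)) =ᵐ[fieldMeasure (F.P j) 0 G] ρ :=
  ae_eq_comp_gaugeAct_of_withDensity (map_gaugeAct_cutTower F ℰ hE hγ ν hν1 hν2 hTs μ χ hχinv hμ1 hμ2 j hjK) hρm hρ0 hμρ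

end Tower

/-! ## §4 The letter for S1aᴴ's own objects (`SU(2)`, `ℰp`, continuous densities, the line's cut) -/

section SU2

variable (F : T3Family) {γ : ℝ}

/-- ★★★ **THE `hcinv` LETTER OF ✓p828515 DISCHARGED** (binders in px8's shape, plus `hχinv`): for S1aᴴ's run system `ν`, every `K`, `Ts ≤ K`, every tower `μ` agreeing with
`ν K` from `Ts` up and cut below by gauge-invariant weights `χ`, every height `j ≤ K` and every CONTINUOUS density `ρᶜ ≥ 0` of `μ j`:
`∀ g, (fun V => ρᶜ (g • V)) =ᵐ[dU] ρᶜ`. [cite: Balaban1985UV3, (41) p.266; Balaban1987RG1, (2.1) p.265] -/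
theorem cutTower_density_ae_gaugeInvariant (hγ : 0 ≤ γ)
    (ν : ℕ → (j : ℕ) → Measure (GaugeField (F.P j) 0 (Matrix.specialUnitaryGroup (Fin 2) ℂ)))
    (hν1 : ∀ K, ν K K = T4GenFunBounds.gibbsMeasure (F.P K) ((F.scheme ℰp γ).β K))
    (hν2 : ∀ K j, j < K → ν K j = Measure.map (descend F ℰp j) (ν K (j + 1)))
    {K Ts : ℕ} (hTs : Ts ≤ K) (μ : (j : ℕ) → Measure (GaugeField (F.P j) 0 (Matrix.specialUnitaryGroup (Fin 2) ℂ)))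
    (χ : (j : ℕ) → GaugeField (F.P j) 0 (Matrix.specialUnitaryGroup (Fin 2) ℂ) → ℝ)
    (hχinv : ∀ (j : ℕ) (u : GaugeTransf (F.P j) 0 (Matrix.specialUnitaryGroup (Fin 2) ℂ)) (U : GaugeField (F.P j) 0 (Matrix.specialUnitaryGroup (Fin 2) ℂ)),
      χ j (GaugeField.gaugeAct u U) = χ j U)
    (hμ1 : ∀ j, Ts ≤ j → μ j = ν K j)
    (hμ2 : ∀ j, j < Ts → μ j = Measure.map (descend F ℰp j) ((μ (j + 1)).withDensity fun U => ENNReal.ofReal (χ (j + 1) U)))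
    {j : ℕ} (hjK : j ≤ K) {ρc : GaugeField (F.P j) 0 (Matrix.specialUnitaryGroup (Fin 2) ℂ) → ℝ} (hcc : Continuous ρc) (hc0 : ∀ V, 0 ≤ ρc V)
    (hμc : μ j = (fieldMeasure (F.P j) 0 (Matrix.specialUnitaryGroup (Fin 2) ℂ)).withDensity (fun V => ENNReal.ofReal (ρc V))) :
    ∀ g : Site (F.P j) 0 → Matrix.specialUnitaryGroup (Fin 2) ℂ,
      (fun V => ρc (GaugeField.gaugeAct g V)) =ᵐ[fieldMeasure (F.P j) 0 (Matrix.specialUnitaryGroup (Fin 2) ℂ)] ρc := by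
  haveI : BorelSpace (GaugeField (F.P j) 0 (Matrix.specialUnitaryGroup (Fin 2) ℂ)) := T3OrbitAverage.instBorelSpaceGaugeField
  exact cutTower_density_ae_gaugeInvariant' F ℰp measurableE_ℰp hγ ν hν1 hν2 hTs μ χ hχinv hμ1 hμ2 hjK hcc.measurable hc0 hμc

/-- ★★ **… AND THE RUN'S DENSITY**: every continuous density `ρᵗ ≥ 0` of `ν K j` (`j ≤ K`) is a.e. gauge invariant. [cite: Balaban1987RG1, (2.1) p.265] -/
theorem run_density_ae_gaugeInvariant (hγ : 0 ≤ γ)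
    (ν : ℕ → (j : ℕ) → Measure (GaugeField (F.P j) 0 (Matrix.specialUnitaryGroup (Fin 2) ℂ)))
    (hν1 : ∀ K, ν K K = T4GenFunBounds.gibbsMeasure (F.P K) ((F.scheme ℰp γ).β K))
    (hν2 : ∀ K j, j < K → ν K j = Measure.map (descend F ℰp j) (ν K (j + 1)))
    {K j : ℕ} (hjK : j ≤ K) {ρt : GaugeField (F.P j) 0 (Matrix.specialUnitaryGroup (Fin 2) ℂ) → ℝ} (htc : Continuous ρt) (ht0 : ∀ V, 0 ≤ ρt V)
    (hνt : ν K j = (fieldMeasure (F.P j) 0 (Matrix.specialUnitaryGroup (Fin 2) ℂ)).withDensity (fun V => ENNReal.ofReal (ρt V))) :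
    ∀ g : Site (F.P j) 0 → Matrix.specialUnitaryGroup (Fin 2) ℂ,
      (fun V => ρt (GaugeField.gaugeAct g V)) =ᵐ[fieldMeasure (F.P j) 0 (Matrix.specialUnitaryGroup (Fin 2) ℂ)] ρt := by
  haveI : BorelSpace (GaugeField (F.P j) 0 (Matrix.specialUnitaryGroup (Fin 2) ℂ)) := T3OrbitAverage.instBorelSpaceGaugeField
  exact ae_eq_comp_gaugeAct_of_withDensity (map_gaugeAct_run F ℰp measurableE_ℰp hγ ν hν1 hν2 K j hjK) htc.measurable ht0 hνt

/-- **THE LINE'S CUT WEIGHT IS GAUGE INVARIANT**: the (½, 24∕25) cut `∏_p max 0 (min 1 ((24∕25·θ − dist1 U(∂p))∕((24∕25 − ½)·θ)))` is a function of the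
`dist1 U(∂p)`, which are class functions (`U^u(∂p) = u(x)U(∂p)u(x)⁻¹`). [cite: Balaban1985Averaging, (9) p.19; Balaban1985UV3, (7) p.257] -/
theorem sfCut2425_gaugeAct {P : Params} {k : ℕ} (θ : ℝ) (u : GaugeTransf P k (Matrix.specialUnitaryGroup (Fin 2) ℂ))
    (U : GaugeField P k (Matrix.specialUnitaryGroup (Fin 2) ℂ)) :
    (∏ p : Plaq P k, max 0 (min 1 ((24 / 25 * θ - dist1 (GaugeField.plaqHol (GaugeField.gaugeAct u U) p)) / ((24 / 25 - 1 / 2) * θ)))) =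
      ∏ p : Plaq P k, max 0 (min 1 ((24 / 25 * θ - dist1 (GaugeField.plaqHol U p)) / ((24 / 25 - 1 / 2) * θ))) := by
  refine Finset.prod_congr rfl fun p _ => ?_
  rw [T4ReTrLipUnitary.plaqHol_gaugeAct, GaugeGroup.dist1_conj]

/-- ★★★ **`hcinv` FOR THE `sfCut`-CUT TOWER, NO HYPOTHESIS ON THE CUT LEFT** (the tower of ✓`…S1aTowerSfCutDock.exists_densities_sfCut`): every continuous density
`ρᶜ ≥ 0` of `μ j` (`j ≤ K`) is a.e. gauge invariant. [cite: Balaban1985UV3, (7) p.257, (41) p.266; Balaban1987RG1, (2.1) p.265] -/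
theorem cutTower_density_ae_gaugeInvariant_sfCut (hγ : 0 ≤ γ) (b₀ p₀ : ℝ)
    (ν : ℕ → (j : ℕ) → Measure (GaugeField (F.P j) 0 (Matrix.specialUnitaryGroup (Fin 2) ℂ)))
    (hν1 : ∀ K, ν K K = T4GenFunBounds.gibbsMeasure (F.P K) ((F.scheme ℰp γ).β K))
    (hν2 : ∀ K j, j < K → ν K j = Measure.map (descend F ℰp j) (ν K (j + 1)))
    {K Ts : ℕ} (hTs : Ts ≤ K) (μ : (j : ℕ) → Measure (GaugeField (F.P j) 0 (Matrix.specialUnitaryGroup (Fin 2) ℂ)))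
    (hμ1 : ∀ j, Ts ≤ j → μ j = ν K j)
    (hμ2 : ∀ j, j < Ts → μ j = Measure.map (descend F ℰp j) ((μ (j + 1)).withDensity (fun U => ENNReal.ofReal
      (∏ p : Plaq (F.P (j + 1)) 0, max 0 (min 1 ((24 / 25 * θBal F.L γ b₀ p₀ (j + 1) - dist1 (GaugeField.plaqHol U p)) /
        ((24 / 25 - 1 / 2) * θBal F.L γ b₀ p₀ (j + 1))))))))
    {j : ℕ} (hjK : j ≤ K) {ρc : GaugeField (F.P j) 0 (Matrix.specialUnitaryGroup (Fin 2) ℂ) → ℝ} (hcc : Continuous ρc) (hc0 : ∀ V, 0 ≤ ρc V)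
    (hμc : μ j = (fieldMeasure (F.P j) 0 (Matrix.specialUnitaryGroup (Fin 2) ℂ)).withDensity (fun V => ENNReal.ofReal (ρc V))) :
    ∀ g : Site (F.P j) 0 → Matrix.specialUnitaryGroup (Fin 2) ℂ,
      (fun V => ρc (GaugeField.gaugeAct g V)) =ᵐ[fieldMeasure (F.P j) 0 (Matrix.specialUnitaryGroup (Fin 2) ℂ)] ρc :=
  cutTower_density_ae_gaugeInvariant F hγ ν hν1 hν2 hTs μ
    (fun i U => ∏ p : Plaq (F.P i) 0, max 0 (min 1 ((24 / 25 * θBal F.L γ b₀ p₀ i - dist1 (GaugeField.plaqHol U p)) /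
      ((24 / 25 - 1 / 2) * θBal F.L γ b₀ p₀ i))))
    (fun _ u U => sfCut2425_gaugeAct _ u U) hμ1 hμ2 hjK hcc hc0 hμc

end SU2

end Summit.QuantumFields.YangMills.Theorems.FluctuationComparisonRegPrIntLS1aCutTowerGaugeInvariant

end
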